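import Literature.NumberTheory.Sieve.DiamondHalberstamTwoLinearCount
import Literature.NumberTheory.Sieve.DiamondHalberstamLinearAlmostPrimes
import Literature.NumberTheory.LFunctions.MidpointSieveGain
import Mathlib.Analysis.SpecialFunctions.Pow.Asymptotics
import HarnessLib

/-!
# Proof of `DiamondHalberstam1997_twoLinear_P5` (Diamond–Halberstam 1997, Table 1, `g = 2`, `r = 5`)

Topic `Literature/NumberTheory/Sieve`. This file DISCHARGES the named fact
`Literature.NumberTheory.Sieve.DiamondHalberstam1997_twoLinear_P5` (`DiamondHalberstamLinearAlmostPrimes.lean`):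
a product of two non-proportional integer linear forms without fixed prime divisor takes, at
infinitely many positive integers, a non-zero value with at most `5` prime factors counted with
multiplicity.

The proof is the weighted sieve of Diamond–Halberstam, Thm 1 (= Halberstam–Richert, *Sieve Methods*,
Thm 10.1: Richert's logarithmic weights on top of a sieve of dimension `κ = 2`), with one
substitution: the Diamond–Halberstam–Richert sieve of dimension `2` (sifting limit `β₂ = 4.2664…`,
giving the printed threshold `r > 4.065…`) is replaced by Iwaniec's Rosser (`β`-) sieve of dimension
`2` (`β₂ = 4.8339…`), whose Theorem 1 the tree PROVES (`RosserSieveTheoremOneHalfLt.lean`); with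
`z = N^{73/500}`, `y = N^{270/500}`, `D = N^{498/500}` the threshold becomes `≈ 4.81`, still `< 5`
(`DH97.eta0_pos`). The chain of PROVED files:
`DiamondHalberstamRichertWeights` (combinatorics of the weights) →
`DiamondHalberstamTwoLinearSetup` (`ω_H`, `Ω(2, L)`, values divisible by `p²`) →
`DiamondHalberstamBetaSieveTwo` (`4.8339 < β₂ ≤ 4.8341`, `f₂(498/73) ≥ 0.02177 A₂`) →
`DiamondHalberstamSieveInputs` (Iwaniec's Thm 1 at `κ = 2` for polynomial sequences) →
`DiamondHalberstamPrimeSum` (the weighted prime sum over `197` pieces, certificate `S_K ≤ 0.046789`) →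
`DiamondHalberstamTwoLinearCount` (the explicit lower bound `DH97.count_ge`) → this file:

* `DH97.tendsto_card_almostPrime_five` — for admissible (positive) coefficients,
  `#{1 ≤ n ≤ N : Ω(H(n)) ≤ 5} → ∞` (indeed `≫ N/log² N`): every error term of `count_ge` is
  `o(N V(z))`, `V(z) ≫ 1/log² z` (`prod_one_sub_rootCount_ge`; `x/log² x → ∞` is the tree's
  `Literature.NumberTheory.LFunctions.tendsto_self_div_log_sq_atTop`).
* `DH97.exists_gt_cardFactors_le_five` — hence such `n` exist beyond every bound.
* `DiamondHalberstam1997_twoLinear_P5_holds` — the reduction of arbitrary integer coefficients with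
  `a₁a₂(a₁b₂ − a₂b₁) ≠ 0` to admissible natural ones: multiply each form by the sign of its leading
  coefficient (the product changes at most by a sign) and translate the variable `n ↦ n + k` so that
  all coefficients become positive ("no fixed prime divisor" is translation invariant modulo `p`).

## References

* H. Diamond, H. Halberstam, *Some applications of sieves of dimension exceeding 1*, LMS LN 237
  (1997), 101–107: Thm 1, (2)–(3), special case 1 and Table 1 (`g = 2 ↦ r = 5`). [DiamondHalberstam1997]
* H. Halberstam, H.-E. Richert, *Sieve Methods* (1974), Thm 10.1, Thm 10.5. [HalberstamRichert1974]
* H. Iwaniec, *Rosser's sieve*, Acta Arith. 36 (1980), Thm 1. [IwaniecActaArith1980]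
-/

open Finset Real Polynomial Filter
open scoped ArithmeticFunction.Omega Topology

noncomputable section

namespace Literature.NumberTheory.Sieve

namespace DH97

open RichertWeights TwoLinear

/-! ### Elementary limits -/

/-- `(log x)^k · x^{−s} → 0` for `s > 0`. [folklore] -/
theorem tendsto_log_pow_mul_rpow_neg (k : ℕ) {s : ℝ} (hs : 0 < s) :
    Tendsto (fun x : ℝ => Real.log x ^ k * x ^ (-s)) atTop (𝓝 0) := by
  have h := (isLittleO_log_rpow_rpow_atTop (k : ℝ) hs).tendsto_div_nhds_zero
  refine h.congr' ?_
  filter_upwards [eventually_gt_atTop (1 : ℝ)] with x hx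
  rw [Real.rpow_natCast, Real.rpow_neg (by linarith : (0 : ℝ) ≤ x), div_eq_mul_inv]

/-- `(c log x)^{−1/3} → 0` for `c > 0`. [folklore] -/
theorem tendsto_mul_log_rpow_neg_third {c : ℝ} (hc : 0 < c) :
    Tendsto (fun x : ℝ => (c * Real.log x) ^ (-(1 / 3 : ℝ))) atTop (𝓝 0) :=
  (tendsto_rpow_neg_atTop (by norm_num : (0 : ℝ) < 1 / 3)).comp (tendsto_log_atTop.const_mul_atTop hc)

/-- `a/(c log x) → 0` for `c > 0`. [folklore] -/
theorem tendsto_const_div_mul_log {a c : ℝ} (hc : 0 < c) :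
    Tendsto (fun x : ℝ => a / (c * Real.log x)) atTop (𝓝 0) :=
  tendsto_const_nhds.div_atTop (tendsto_log_atTop.const_mul_atTop hc)

/-! ### The count tends to infinity -/

variable {a₁ b₁ a₂ b₂ : ℕ}

/-- **For admissible coefficients, `#{1 ≤ n ≤ N : Ω(H(n)) ≤ 5} → ∞`** (indeed `≫ N/log² N`,
Diamond–Halberstam (2) with `g = 2`): in the explicit inequality `count_ge` the main term is
`N V(z) A₂ η₀ ≫ N/log² N` (`V(z) ≫ 1/log² z`), the relative errors `(log N)^{−1/3}`, `1/log N` tend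
to `0`, and `D e⁸ log² z`, `N/z`, `y` are `O(N^{498/500} log² N) = o(N/log² N)`.
[cite: DiamondHalberstam1997, (2) with Table 1 (g = 2, r = 5)] -/
theorem tendsto_card_almostPrime_five (h : Admissible a₁ b₁ a₂ b₂) :
    Tendsto (fun N : ℕ => (#((Ioc 0 N).filter fun n : ℕ => Ω (val a₁ b₁ a₂ b₂ n) ≤ 5) : ℝ)) atTop atTop := by
  obtain ⟨C₁, C₂, hC₁, hC₂, hcount⟩ := count_ge h
  set H := poly a₁ b₁ a₂ b₂ with hH
  have h2 : polyRootCountMod ![H] 2 ≤ 1 := rootCount_two_le_one h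
  have hle : ∀ p : ℕ, p.Prime → polyRootCountMod ![H] p ≤ 2 := fun p hp => rootCount_le_two h hp
  -- constants
  have hg0 : 0 < gExp := by rw [gExp]; norm_num
  have hα0 : 0 < αExp := by rw [αExp]; norm_num
  have hθ0 : 0 < θExp := by rw [θExp]; norm_num
  have hθα : 0 < θExp - αExp := by rw [αExp, θExp]; norm_num
  have hθ1 : 0 < 1 - θExp := by rw [θExp]; norm_num
  have hg1 : 1 - gExp ≤ θExp := by rw [gExp, θExp]; norm_num
  have hαθ : αExp ≤ θExp := by rw [αExp, θExp]; norm_num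
  set A := iwaniecSieveConst 2 with hAdef
  have hA : 0 < A := BetaSieveTwo.iwaniecSieveConst_two_pos
  have hη := eta0_pos
  have hAη : 0 < A * eta0 := mul_pos hA hη
  have hlam := lamW_pos
  have hL0 := L₀_nonneg
  set c₀ : ℝ := Real.log 2 ^ 2 / (1 + 106 * Real.exp (106 / Real.log 2) / Real.log 2) with hc₀
  have hc₀pos : 0 < c₀ := by
    have : 0 < Real.log 2 := Real.log_pos one_lt_two
    positivity
  -- the error functions of a real variable
  set E₁ : ℝ → ℝ := fun x => C₁ * (θExp * Real.log x) ^ (-(1 / 3 : ℝ)) +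
    lamW⁻¹ * (197 * A * (L₀ / (gExp * Real.log x)) +
      C₂ * ((θExp - αExp) * Real.log x) ^ (-(1 / 3 : ℝ)) * (6 + 197 * (L₀ / (gExp * Real.log x)))) with hE₁
  set E₂ : ℝ → ℝ := fun x => x ^ θExp * (Real.exp 8 * Real.log (x ^ gExp) ^ 2) *
      (1 + lamW⁻¹ * (6 + L₀ / (gExp * Real.log x))) + (4 * x / x ^ gExp + 2 * (x ^ αExp + 1)) with hE₂
  set m : ℝ → ℝ := fun x => c₀ * x / (gExp * Real.log x) ^ 2 with hm
  -- `E₁ → 0`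
  have hE₁lim : Tendsto E₁ atTop (𝓝 0) := by
    have h1 := tendsto_mul_log_rpow_neg_third hθ0
    have h2 := tendsto_const_div_mul_log (a := L₀) hg0
    have h3 := tendsto_mul_log_rpow_neg_third hθα
    have h4 : Tendsto (fun x : ℝ => 6 + 197 * (L₀ / (gExp * Real.log x))) atTop (𝓝 (6 + 197 * 0)) :=
      tendsto_const_nhds.add (h2.const_mul 197)
    have h5 := ((h1.const_mul C₁).add
      ((((h2.const_mul (197 * A)).add ((h3.const_mul C₂).mul h4))).const_mul lamW⁻¹))
    simp only [mul_zero, zero_mul, add_zero] at h5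
    exact h5
  -- `m → ∞`
  have hmlim : Tendsto m atTop atTop := by
    have h := Literature.NumberTheory.LFunctions.tendsto_self_div_log_sq_atTop.const_mul_atTop
      (div_pos hc₀pos (pow_pos hg0 2))
    refine h.congr' ?_
    filter_upwards [eventually_gt_atTop (0 : ℝ)] with x hx
    simp only [hm]
    field_simp
  -- `E₂ ≤ K x^θ (log x)²` for large `x`, and `x^θ (log x)² / m(x) → 0`
  set K : ℝ := Real.exp 8 * gExp ^ 2 * (1 + lamW⁻¹ * (6 + L₀ / gExp)) + 8 with hK
  have hKpos : 0 < K := by positivity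
  have hE₂le : ∀ᶠ x : ℝ in atTop, E₂ x ≤ K * (x ^ θExp * Real.log x ^ 2) := by
    filter_upwards [eventually_ge_atTop (Real.exp 1)] with x hx
    have hx1 : 1 < x := lt_of_lt_of_le (by have := Real.add_one_le_exp (1:ℝ); linarith) hx
    have hx0 : 0 < x := by linarith
    have hlog1 : 1 ≤ Real.log x := by
      rw [← Real.log_exp 1]; exact Real.log_le_log (Real.exp_pos 1) hx
    have hlog0 : 0 < Real.log x := by linarith
    have hxθ : 1 ≤ x ^ θExp := Real.one_le_rpow hx1.le hθ0.le
    have hpow : 1 ≤ x ^ θExp * Real.log x ^ 2 := by nlinarith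
    -- the three algebraic terms
    have t1 : x ^ θExp * (Real.exp 8 * Real.log (x ^ gExp) ^ 2) * (1 + lamW⁻¹ * (6 + L₀ / (gExp * Real.log x))) ≤
        Real.exp 8 * gExp ^ 2 * (1 + lamW⁻¹ * (6 + L₀ / gExp)) * (x ^ θExp * Real.log x ^ 2) := by
      rw [Real.log_rpow hx0]
      have hε : L₀ / (gExp * Real.log x) ≤ L₀ / gExp :=
        div_le_div_of_nonneg_left hL0 hg0 (le_mul_of_one_le_right hg0.le hlog1)
      have hfac : 1 + lamW⁻¹ * (6 + L₀ / (gExp * Real.log x)) ≤ 1 + lamW⁻¹ * (6 + L₀ / gExp) := by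
        have hli := (inv_pos.mpr hlam).le
        have := mul_le_mul_of_nonneg_left (add_le_add_left hε 6) hli
        linarith
      have hbase : 0 ≤ x ^ θExp * (Real.exp 8 * (gExp * Real.log x) ^ 2) := by positivity
      calc x ^ θExp * (Real.exp 8 * (gExp * Real.log x) ^ 2) * (1 + lamW⁻¹ * (6 + L₀ / (gExp * Real.log x)))
          ≤ x ^ θExp * (Real.exp 8 * (gExp * Real.log x) ^ 2) * (1 + lamW⁻¹ * (6 + L₀ / gExp)) :=
            mul_le_mul_of_nonneg_left hfac hbase
        _ = Real.exp 8 * gExp ^ 2 * (1 + lamW⁻¹ * (6 + L₀ / gExp)) * (x ^ θExp * Real.log x ^ 2) := by ring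
    have hl2 : 1 ≤ Real.log x ^ 2 := by nlinarith
    have hθl : x ^ θExp ≤ x ^ θExp * Real.log x ^ 2 := le_mul_of_one_le_right (by positivity) hl2
    have t2 : 4 * x / x ^ gExp ≤ 4 * (x ^ θExp * Real.log x ^ 2) := by
      have e : 4 * x / x ^ gExp = 4 * x ^ (1 - gExp) := by
        rw [Real.rpow_sub hx0, Real.rpow_one, mul_div_assoc]
      rw [e]
      have : x ^ (1 - gExp) ≤ x ^ θExp := Real.rpow_le_rpow_of_exponent_le hx1.le hg1
      linarith
    have t3 : 2 * (x ^ αExp + 1) ≤ 4 * (x ^ θExp * Real.log x ^ 2) := by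
      have : x ^ αExp ≤ x ^ θExp := Real.rpow_le_rpow_of_exponent_le hx1.le hαθ
      linarith
    simp only [hE₂, hK]
    linarith [t1, t2, t3]
  have hratio : Tendsto (fun x : ℝ => K * (x ^ θExp * Real.log x ^ 2) / m x) atTop (𝓝 0) := by
    have h := (tendsto_log_pow_mul_rpow_neg 4 hθ1).const_mul (K * gExp ^ 2 / c₀)
    rw [mul_zero] at h
    refine h.congr' ?_
    filter_upwards [eventually_gt_atTop (1 : ℝ)] with x hx
    have hx0 : 0 < x := by linarith
    have hlog0 : 0 < Real.log x := Real.log_pos hx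
    simp only [hm]
    rw [Real.rpow_neg hx0.le, Real.rpow_sub hx0, Real.rpow_one]
    field_simp
  -- eventual side conditions along `N : ℕ`
  have hcast := tendsto_natCast_atTop_atTop (R := ℝ)
  have ev_z : ∀ᶠ N : ℕ in atTop, 2 ≤ (N : ℝ) ^ gExp ∧
      (max a₁ (max a₂ (((a₁ : ℤ) * b₂ - a₂ * b₁).natAbs)) : ℝ) < (N : ℝ) ^ gExp := by
    have hz := (tendsto_rpow_atTop hg0).comp hcast
    filter_upwards [hz.eventually_ge_atTop 2,
      hz.eventually_gt_atTop ((max a₁ (max a₂ (((a₁ : ℤ) * b₂ - a₂ * b₁).natAbs)) : ℝ))] with N h1 h2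
    exact ⟨h1, h2⟩
  have ev_CH : ∀ᶠ N : ℕ in atTop, Real.log (((a₁ + b₁) * (a₂ + b₂) : ℕ) : ℝ) ≤ αExp / 100 * Real.log N := by
    have hl := (tendsto_log_atTop.comp hcast).const_mul_atTop (div_pos hα0 (by norm_num : (0:ℝ) < 100))
    exact hl.eventually_ge_atTop _
  have ev_E₁ : ∀ᶠ N : ℕ in atTop, E₁ N < A * eta0 / 2 :=
    (hE₁lim.comp hcast).eventually (gt_mem_nhds (by positivity))
  have ev_E₂ : ∀ᶠ N : ℕ in atTop, E₂ N ≤ A * eta0 / 4 * m N := by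
    have h1 : ∀ᶠ x : ℝ in atTop, K * (x ^ θExp * Real.log x ^ 2) / m x < A * eta0 / 4 :=
      hratio.eventually (gt_mem_nhds (by positivity))
    have h2 : ∀ᶠ x : ℝ in atTop, 0 < m x := hmlim.eventually_gt_atTop 0
    have h3 : ∀ᶠ x : ℝ in atTop, E₂ x ≤ A * eta0 / 4 * m x := by
      filter_upwards [h1, h2, hE₂le] with x hx1 hx2 hx3
      rw [div_lt_iff₀ hx2] at hx1
      linarith
    exact hcast.eventually h3
  -- the eventual lower bound `count ≥ (A η₀/4) m(N)`
  have hV : ∀ N : ℕ, 2 ≤ (N : ℝ) ^ gExp →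
      c₀ / (gExp * Real.log N) ^ 2 ≤
        ∏ q ∈ Nat.primesBelow ⌈(N : ℝ) ^ gExp⌉₊, (1 - (polyRootCountMod ![H] q : ℝ) / q) := by
    intro N hN
    have hn1 : 1 < (N : ℝ) := one_lt_of_two_le_rpow (Nat.cast_nonneg N) hg0 hN
    have h := prod_one_sub_rootCount_ge h2 hle hN
    rw [Real.log_rpow (by linarith)] at h
    simpa [hc₀, div_div] using h
  have ev_main : ∀ᶠ N : ℕ in atTop,
      A * eta0 / 4 * m N ≤ (#((Ioc 0 N).filter fun n : ℕ => Ω (val a₁ b₁ a₂ b₂ n) ≤ 5) : ℝ) := by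
    filter_upwards [ev_z, ev_CH, ev_E₁, ev_E₂, hcast.eventually (hmlim.eventually_gt_atTop 0)]
      with N hz hCH hE₁N hE₂N hmN
    have hc := hcount N hz.1 hz.2 hCH
    have hn1 : 1 < (N : ℝ) := one_lt_of_two_le_rpow (Nat.cast_nonneg N) hg0 hz.1
    have hn0 : 0 < (N : ℝ) := by linarith
    have hlogn : 0 < Real.log N := Real.log_pos hn1
    set V := ∏ q ∈ Nat.primesBelow ⌈(N : ℝ) ^ gExp⌉₊, (1 - (polyRootCountMod ![H] q : ℝ) / q) with hVdef
    have hVge := hV N hz.1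
    have hVpos : 0 < V := prod_one_sub_rootCount_pos h2 hle _
    -- `N V ≥ m(N)`
    have hNV : m N ≤ (N : ℝ) * V := by
      simp only [hm]
      rw [div_eq_mul_one_div, mul_comm c₀, mul_assoc, mul_one_div]
      exact mul_le_mul_of_nonneg_left hVge hn0.le
    -- rewrite `hc` through `E₁`, `E₂`
    have hc' : (N : ℝ) * V * (A * eta0 - E₁ N) - E₂ N ≤
        #((Ioc 0 N).filter fun n : ℕ => Ω (val a₁ b₁ a₂ b₂ n) ≤ 5) := by
      have e : (N : ℝ) * V * (A * eta0 - E₁ N) - E₂ N =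
          (N : ℝ) * V * (A * eta0 - C₁ * (θExp * Real.log N) ^ (-(1 / 3 : ℝ)) -
            lamW⁻¹ * (197 * A * (L₀ / (gExp * Real.log N)) +
              C₂ * ((θExp - αExp) * Real.log N) ^ (-(1 / 3 : ℝ)) * (6 + 197 * (L₀ / (gExp * Real.log N))))) -
          (N : ℝ) ^ θExp * (Real.exp 8 * Real.log ((N : ℝ) ^ gExp) ^ 2) *
            (1 + lamW⁻¹ * (6 + L₀ / (gExp * Real.log N))) -
          (4 * N / (N : ℝ) ^ gExp + 2 * ((N : ℝ) ^ αExp + 1)) := by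
        simp only [hE₁, hE₂]; ring
      rw [e]; exact hc
    have h1 : (N : ℝ) * V * (A * eta0 / 2) ≤ (N : ℝ) * V * (A * eta0 - E₁ N) :=
      mul_le_mul_of_nonneg_left (by linarith) (mul_nonneg hn0.le hVpos.le)
    have h2 : m N * (A * eta0 / 2) ≤ (N : ℝ) * V * (A * eta0 / 2) :=
      mul_le_mul_of_nonneg_right hNV (by positivity)
    linarith
  -- conclude
  refine tendsto_atTop_mono' atTop ev_main ?_
  exact (hmlim.comp hcast).const_mul_atTop (by positivity)

/-- **Admissible products of two linear forms take `P₅` values beyond every bound**: for every `N₀`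
there is `n > N₀` with `Ω((a₁n+b₁)(a₂n+b₂)) ≤ 5`. [cite: DiamondHalberstam1997, Table 1 (g = 2, r = 5)] -/
theorem exists_gt_cardFactors_le_five (h : Admissible a₁ b₁ a₂ b₂) (N₀ : ℕ) :
    ∃ n : ℕ, N₀ < n ∧ Ω (val a₁ b₁ a₂ b₂ n) ≤ 5 := by
  have ht := tendsto_card_almostPrime_five h
  obtain ⟨N, hN⟩ := (ht.eventually_gt_atTop (N₀ : ℝ)).exists
  by_contra hcon
  push Not at hcon
  have hsub : (Ioc 0 N).filter (fun n : ℕ => Ω (val a₁ b₁ a₂ b₂ n) ≤ 5) ⊆ Ioc 0 N₀ := by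
    intro n hn
    rw [Finset.mem_filter, Finset.mem_Ioc] at hn
    rw [Finset.mem_Ioc]
    refine ⟨hn.1.1, ?_⟩
    by_contra hgt
    push Not at hgt
    exact absurd hn.2 (not_le.mpr (hcon n hgt))
  have := Finset.card_le_card hsub
  rw [Nat.card_Ioc, Nat.sub_zero] at this
  have : (#((Ioc 0 N).filter fun n : ℕ => Ω (val a₁ b₁ a₂ b₂ n) ≤ 5) : ℝ) ≤ N₀ := by exact_mod_cast this
  linarith

end DH97

/-! ### The reduction to admissible coefficients and the proof of the fact -/

open TwoLinear in
/-- **Reduction step**: for integers `a₁, b₁, a₂, b₂` with `a₁a₂(a₁b₂ − a₂b₁) ≠ 0` and no fixed prime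
divisor there are admissible natural coefficients `A₁, B₁, A₂, B₂`, a shift `k` and a sign
`σ ∈ {±1}` with `(a₁(m+k)+b₁)(a₂(m+k)+b₂) = σ · (A₁m+B₁)(A₂m+B₂)` for all `m`
(`Aᵢ = |aᵢ|`, `Bᵢ = sign(aᵢ)(aᵢk + bᵢ)`, `k = |b₁| + |b₂| + 1`). [folklore] -/
theorem TwoLinear.exists_admissible_shift (a₁ b₁ a₂ b₂ : ℤ) (hne : a₁ * a₂ * (a₁ * b₂ - a₂ * b₁) ≠ 0)
    (hfix : ∀ p : ℕ, p.Prime → ∃ n : ℕ, ¬ (p : ℤ) ∣ (a₁ * n + b₁) * (a₂ * n + b₂)) :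
    ∃ (A₁ B₁ A₂ B₂ k : ℕ) (σ : ℤ), (σ = 1 ∨ σ = -1) ∧ Admissible A₁ B₁ A₂ B₂ ∧
      ∀ m : ℕ, (a₁ * ((m + k : ℕ) : ℤ) + b₁) * (a₂ * ((m + k : ℕ) : ℤ) + b₂) =
        σ * (val A₁ B₁ A₂ B₂ m : ℤ) := by
  have ha₁ : a₁ ≠ 0 := fun h0 => hne (by rw [h0]; ring)
  have ha₂ : a₂ ≠ 0 := fun h0 => hne (by rw [h0]; ring)
  have hΔ : a₁ * b₂ - a₂ * b₁ ≠ 0 := fun h0 => hne (by rw [h0]; ring)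
  set s₁ := a₁.sign with hs₁
  set s₂ := a₂.sign with hs₂
  have hsq : ∀ {a : ℤ}, a ≠ 0 → a.sign = 1 ∨ a.sign = -1 := by
    intro a ha
    rcases lt_trichotomy a 0 with hlt | rfl | hgt
    · exact Or.inr (Int.sign_eq_neg_one_of_neg hlt)
    · exact absurd rfl ha
    · exact Or.inl (Int.sign_eq_one_of_pos hgt)
  have hs₁sq : s₁ * s₁ = 1 := by rcases hsq ha₁ with h | h <;> simp [hs₁, h]
  have hs₂sq : s₂ * s₂ = 1 := by rcases hsq ha₂ with h | h <;> simp [hs₂, h]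
  have hs₁a : s₁ * a₁ = |a₁| := Int.sign_mul_self_eq_abs a₁
  have hs₂a : s₂ * a₂ = |a₂| := Int.sign_mul_self_eq_abs a₂
  have hs₁le : s₁ * b₁ ≥ -|b₁| := by
    rcases hsq ha₁ with h | h
    · rw [hs₁, h, one_mul]; linarith [neg_abs_le b₁]
    · rw [hs₁, h, neg_one_mul]; linarith [le_abs_self b₁]
  have hs₂le : s₂ * b₂ ≥ -|b₂| := by
    rcases hsq ha₂ with h | h
    · rw [hs₂, h, one_mul]; linarith [neg_abs_le b₂]
    · rw [hs₂, h, neg_one_mul]; linarith [le_abs_self b₂]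
  set k : ℕ := b₁.natAbs + b₂.natAbs + 1 with hk
  have hk' : (k : ℤ) = |b₁| + |b₂| + 1 := by
    rw [hk]; push_cast; ring
  have hA₁pos : 0 < a₁.natAbs := Int.natAbs_pos.mpr ha₁
  have hA₂pos : 0 < a₂.natAbs := Int.natAbs_pos.mpr ha₂
  have h1a₁ : (1 : ℤ) ≤ |a₁| := Int.one_le_abs ha₁
  have h1a₂ : (1 : ℤ) ≤ |a₂| := Int.one_le_abs ha₂
  have hk0 : (0 : ℤ) ≤ k := by positivity
  -- the shifted constant terms are positive
  have hB₁pos : 0 < s₁ * (a₁ * k + b₁) := by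
    have e : s₁ * (a₁ * k + b₁) = |a₁| * k + s₁ * b₁ := by rw [← hs₁a]; ring
    rw [e]
    have : (k : ℤ) ≤ |a₁| * k := le_mul_of_one_le_left hk0 h1a₁
    linarith [abs_nonneg b₁, abs_nonneg b₂]
  have hB₂pos : 0 < s₂ * (a₂ * k + b₂) := by
    have e : s₂ * (a₂ * k + b₂) = |a₂| * k + s₂ * b₂ := by rw [← hs₂a]; ring
    rw [e]
    have : (k : ℤ) ≤ |a₂| * k := le_mul_of_one_le_left hk0 h1a₂
    linarith [abs_nonneg b₁, abs_nonneg b₂]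
  set B₁ : ℕ := (s₁ * (a₁ * k + b₁)).toNat with hB₁
  set B₂ : ℕ := (s₂ * (a₂ * k + b₂)).toNat with hB₂
  have hB₁eq : (B₁ : ℤ) = s₁ * (a₁ * k + b₁) := Int.toNat_of_nonneg hB₁pos.le
  have hB₂eq : (B₂ : ℤ) = s₂ * (a₂ * k + b₂) := Int.toNat_of_nonneg hB₂pos.le
  -- the key identity
  have hval : ∀ m : ℕ, (a₁ * ((m + k : ℕ) : ℤ) + b₁) * (a₂ * ((m + k : ℕ) : ℤ) + b₂) =
      (s₁ * s₂) * (val a₁.natAbs B₁ a₂.natAbs B₂ m : ℤ) := by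
    intro m
    unfold val
    push_cast
    rw [hB₁eq, hB₂eq, ← hs₁a, ← hs₂a]
    have e : s₁ * s₂ * ((s₁ * a₁ * (m : ℤ) + s₁ * (a₁ * k + b₁)) * (s₂ * a₂ * (m : ℤ) + s₂ * (a₂ * k + b₂))) =
        (s₁ * s₁) * (s₂ * s₂) * ((a₁ * (m + k) + b₁) * (a₂ * (m + k) + b₂)) := by ring
    rw [e, hs₁sq, hs₂sq]; ring
  refine ⟨a₁.natAbs, B₁, a₂.natAbs, B₂, k, s₁ * s₂, ?_, ?_, hval⟩
  · rcases hsq ha₁ with h1 | h1 <;> rcases hsq ha₂ with h2 | h2 <;> simp [hs₁, hs₂, h1, h2]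
  refine ⟨hA₁pos, ?_, hA₂pos, ?_, ?_, ?_⟩
  · have : (0 : ℤ) < B₁ := by rw [hB₁eq]; exact hB₁pos
    exact_mod_cast this
  · have : (0 : ℤ) < B₂ := by rw [hB₂eq]; exact hB₂pos
    exact_mod_cast this
  · -- non-proportionality
    intro hprop
    apply hΔ
    have h1 : ((a₁.natAbs * B₂ : ℕ) : ℤ) = ((a₂.natAbs * B₁ : ℕ) : ℤ) := by exact_mod_cast hprop
    push_cast at h1
    rw [hB₁eq, hB₂eq, ← hs₁a, ← hs₂a] at h1
    have e : s₁ * a₁ * (s₂ * (a₂ * k + b₂)) - s₂ * a₂ * (s₁ * (a₁ * k + b₁)) = (s₁ * s₂) * (a₁ * b₂ - a₂ * b₁) := by ring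
    have h2 : (s₁ * s₂) * (a₁ * b₂ - a₂ * b₁) = 0 := by rw [← e]; linarith
    have hs : s₁ * s₂ ≠ 0 := by
      intro h0
      have : (s₁ * s₁) * (s₂ * s₂) = 0 := by
        calc (s₁ * s₁) * (s₂ * s₂) = (s₁ * s₂) * (s₁ * s₂) := by ring
          _ = 0 := by rw [h0]; ring
      rw [hs₁sq, hs₂sq] at this
      exact one_ne_zero this
    exact (mul_eq_zero.mp h2).resolve_left hs
  · -- no fixed prime divisor (translation invariance mod `p`)
    intro p hp
    obtain ⟨n, hn⟩ := hfix p hp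
    refine ⟨n + (p - 1) * k, fun hdvd => hn ?_⟩
    have hval' := hval (n + (p - 1) * k)
    have hdz : (p : ℤ) ∣ (val a₁.natAbs B₁ a₂.natAbs B₂ (n + (p - 1) * k) : ℤ) := by exact_mod_cast hdvd
    have h1 : (p : ℤ) ∣ (a₁ * ((n + (p - 1) * k + k : ℕ) : ℤ) + b₁) * (a₂ * ((n + (p - 1) * k + k : ℕ) : ℤ) + b₂) := by
      rw [hval']; exact dvd_mul_of_dvd_right hdz _
    have hpk : ((n + (p - 1) * k + k : ℕ) : ℤ) = (n : ℤ) + p * k := by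
      have hp1 : 1 ≤ p := hp.one_lt.le
      push_cast [Nat.sub_mul, Nat.cast_sub (Nat.mul_le_mul_right k hp1)]
      ring
    rw [hpk] at h1
    have e : (a₁ * ((n : ℤ) + p * k) + b₁) * (a₂ * ((n : ℤ) + p * k) + b₂) =
        (a₁ * n + b₁) * (a₂ * n + b₂) + p * (k * (a₁ * (a₂ * ((n : ℤ) + p * k) + b₂) + a₂ * (a₁ * n + b₁))) := by
      ring
    rw [e] at h1
    exact (dvd_add_left (dvd_mul_right _ _)).mp h1

/-- **Diamond–Halberstam 1997, Table 1, `g = 2` (`r = 5`) — PROVED.** A product of two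
non-proportional integer linear forms without fixed prime divisor takes, at infinitely many
positive integers, a (non-zero) value with at most `5` prime factors counted with multiplicity.
(Weighted sieve of Diamond–Halberstam Thm 1 / Halberstam–Richert Thm 10.1 with Iwaniec's
two-dimensional `β`-sieve; see the module docstring for the chain of files.)
[cite: DiamondHalberstam1997, Table 1 (g = 2) with display (2), pp. 102–104] -/
theorem DiamondHalberstam1997_twoLinear_P5_holds : DiamondHalberstam1997_twoLinear_P5 := by
  intro a₁ b₁ a₂ b₂ hne hfix N₀
  obtain ⟨A₁, B₁, A₂, B₂, k, σ, hσ, hadm, hval⟩ := TwoLinear.exists_admissible_shift a₁ b₁ a₂ b₂ hne hfix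
  obtain ⟨m, hm, hΩ⟩ := DH97.exists_gt_cardFactors_le_five hadm N₀
  refine ⟨m + k, by omega, ?_⟩
  have hv0 : TwoLinear.val A₁ B₁ A₂ B₂ m ≠ 0 := (TwoLinear.val_pos hadm m).ne'
  have habs : ((a₁ * ((m + k : ℕ) : ℤ) + b₁) * (a₂ * ((m + k : ℕ) : ℤ) + b₂)).natAbs =
      TwoLinear.val A₁ B₁ A₂ B₂ m := by
    rw [hval m, Int.natAbs_mul, Int.natAbs_natCast]
    rcases hσ with h | h <;> simp [h]
  rw [habs]
  exact ⟨hv0, hΩ⟩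

end Literature.NumberTheory.Sieve

end
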